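import Summits.ResolutionOfSingularities.ResolutionOfSingularities.Theorems.MarkedTransferCampaignW14K14ElimArc
import Summits.ResolutionOfSingularities.ResolutionOfSingularities.Theorems.MarkedTransferCampaignW14ElimAlgebra
import Summits.ResolutionOfSingularities.ResolutionOfSingularities.Theorems.MarkedTransferCampaignW14K14ElimWitnesses
import HarnessLib

/-!
# [OURS · L1 W1.4 / K1.4 (ii), kernel-general at the witness] The elimination ideals of W1 in ALL degrees,
# `J_k(Ě_{W1}, β) = (w^{2k})`, and the transformation law on W1's first transform at `ξ′` — the literal instance of
# `CampaignW14.ElimTransformLawChart` (seat res-L1-k14, kill test K1.4, slot W1.4 «elimination algebra instead of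
# negative modules», KILL-TEST-ONLY; verdict ALIVE(A) of record 2026-08-27T02:19:59Z / director 02:21:08Z)

LADDER-RESOLUTION rung L (rescue), cell `res-hironaka`; host `--supports stmt-ResolutionOfSingularities-15522` like
the sibling K1.4 files `MarkedTransferCampaignW14K14ElimWitnesses.lean` (p486835) and part I
`MarkedTransferCampaignW14K14ElimArc.lean` (the arc lemma). The K1.4 report (`L/res-L1-k14/KILL-TEST-K1.4.md`) scored
the law on W1's `x`-chart «INSTANCE ✓ CAS, k ≤ 4, EQUALITY (kit j265389) · kernel-general OPEN (valuative upper bound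
on `℘`, priced 1–2 prover-days)» (§4 (β), §5 F1). This file CLOSES that cell: the law holds in the kernel for EVERY
degree `k`, for the typed algebraic `℘` INCLUDING its integral closure, as the literal `Prop` of res-L1-type-o2's
schema `CampaignW14.ElimTransformLawChart` (`MarkedTransferCampaignW14ElimAlgebra.lean`, p487788), instantiated at
`σ = Nega.xChart`, `u = u′ = x`, `J = (Nega.g3)`, `b = 2`, base structures `β^* = β₁^* = rename ![0,2]`.

HONEST FRAMING. Nothing here is a statement of H. Hironaka's manuscript (2017-03-23, [Hironaka2017]) nor of
Villamayor 2007 / Bravo–Villamayor 2010, and nothing asserts that any printed statement holds. The objects are the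
tree's REAL definitions (row 003's ALGEBRAIC `℘` = `S04CharAlgebra.pAlgebraicRing`, a CANDIDATE definition under
adjudication; o2's `Campaign.elimAlgPiece`, `Campaign.weakPiece`, `CampaignW14.ElimTransformLawChart`) instantiated on
EXPLICIT polynomials over `𝔽₂` (`Nega.g3 = y² + xw²`, `Nega.xChart`: the R04 calibration witness of `NegaWitness.lean`).
Every theorem is elementary commutative algebra (tag [folklore]); AI review is weaker than expert review; not progress
on resolution of singularities in positive characteristic; no claim beyond the kernel. No `sorry`; axioms standard.

## Method
Part I gives, for every arc `ψ` killing `g` and every prime power `π^e ∣ ψ(w)²`, `π^{ek} ∣ ψ(a)` whenever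
`a·X^k ∈ ℘(Ě_{W1})` (closure included), and the Frobenius arc `φ` (`x ↦ s²`, `y ↦ st²`, `w ↦ t²`) with `φ(β^*c) = c²`.
Upstairs (§5): `t⁴ ∣ φ(w)²`, so `t^{4k} ∣ c²` for `c ∈ J_k`, i.e. `w^{2k} ∣ c`; with `w²·X ∈ ℘` (`∂_x g = w²`) this is
`J_k = (w^{2k})` EXACTLY (K1.4 report table 2.1 row W1 had `k ≤ 4` by Gröbner bases on the algebra WITHOUT closure +
V2007 Th 4.11 as dictionary). Downstairs (§6): `ψ = φ ∘ σ` has `ψ(w)² = s⁴t⁴`; an element `c ∈ S₁ = 𝔽₂[x,w₁]` of the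
envelope of the weak transform (`β₁^*c·x^k ∈ ℘(Ě,k)·O₁`) therefore has `s^{4k}t^{4k} ∣ c²s^{2k}`, i.e.
`x^k·w₁^{2k} ∣ c` (`W1_xChart_dvd`) — the LHS of the law is `((x·w₁²)^k)` EXACTLY (`W1_xChart_lhs_eq`; the factor
`x^k = I(H)^k` is the exceptional MONOMIAL factor of the report's located ceiling §2.4) and lies IN the weak transform
`(J_k S₁ : x^k) ∋ x^k w₁^{2k}` of the elimination ideals: membership, a fortiori integrality —
`W1_xChart_elimTransformLaw`. With o2's proved cheap half `Campaign.weakPiece_elim_le`: equality, as the CAS found.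

## What is proved
§5 `W1_sq_mem_pAlgebraicRing` (`w²·X ∈ ℘`, from p486835's `pderiv0_g1 : ∂_x g = w²`), `W1_sq_pow_mem_homogPiece` (`w^{2k} ∈ ℘(Ě,k)`),
   `W1_homogPiece_comap_le` (`℘(Ě,k) ∩ 𝔽₂[x,w] ⊆ (w^{2k})`), **`W1_elimAlgPiece_eq`** (`J_k = (w^{2k})`, o2's name).
§6 `xChart_comp_rename` (compatible charts), **`W1_xChart_dvd`**, `W1_xChart_monomial_mem`, **`W1_xChart_lhs_eq`**
   (`(℘(Ě,k)O₁ : x^k) ∩ S₁ = ((x·w₁²)^k)`), **`W1_xChart_elimTransformLaw : CampaignW14.ElimTransformLawChart …`**.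
The base structure `𝔽₂[x,w] → 𝔽₂[x,y,w]` is supplied to o2's schema as the term `(rename ![0,2]).toRingHom.toAlgebra`
(a `letI` in the statements; no instance is declared).

## References
* H. Hironaka, ms. 2017-03-23, §4 p.17 l.8–11 (U17_2) — scope only, under adjudication. [Hironaka2017]
* O. Villamayor U., Adv. Math. 213 (2007) = arXiv:math/0606796, Def 4.10 / Th 4.11 p.22, Def 6.1 p.29, §6.7 p.30;
  A. Bravo, O. Villamayor U., Adv. Math. 224 (2010) = arXiv:0807.4308, §2.7–2.9, Th 3.1 (ii)(b) p.26 — scope of the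
  slot (the schema's docstring), not cited as facts. [Villamayor2007] [BravoVillamayor2010]
* Cell res-hironaka: `L/res-L1-k14/KILL-TEST-K1.4.md` §2.1 / §2.2 / §2.4 / §4 (β) / §5 F1, kit j265389, p486835, p487788.
-/

noncomputable section

set_option linter.dupNamespace false -- mandated namespace of this single-conjunct summit

namespace Summit.ResolutionOfSingularities.ResolutionOfSingularities.Theorems.Campaign.W14.Law

open Literature.AlgebraicGeometry.Resolution
open Literature.AlgebraicGeometry.Hironaka2017
open Literature.AlgebraicGeometry.Hironaka2017.S04CharAlgebra (homogPiece pAlgebraicRing diffSubalgebra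
  familySubalgebra)
open Summit.ResolutionOfSingularities.ResolutionOfSingularities.Theorems.Campaign
open MvPolynomial (X rename aeval pderiv)

/-! ## §5 Upstairs, all degrees: `J_k(Ě_{W1}, β) = ℘(Ě,k) ∩ 𝔽₂[x,w] = (w^{2k})`, integral closure included -/

section Upstairs

/-- `w²·X ∈ ℘(Ě_{W1})`: `w² = ∂_x g ∈ Diff^{(1)}(g)` is a degree-one GENERATOR (`j = 1 < b = 2`; `∂_x g = w²` is
p486835's `pderiv0_g1`; cf. its `W1_elim_one_mem`, the same fact in `pAlgPiece`/`comap` form). [folklore] -/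
theorem W1_sq_mem_pAlgebraicRing :
    Polynomial.monomial 1 (X 2 ^ 2 : MvPolynomial (Fin 3) (ZMod 2)) ∈
      pAlgebraicRing (ZMod 2) (MvPolynomial (Fin 3) (ZMod 2)) (Ideal.span {Nega.g3}) 2 := by
  have hmem : Polynomial.monomial 1 (X 2 ^ 2 : MvPolynomial (Fin 3) (ZMod 2)) ∈
      diffSubalgebra (ZMod 2) (MvPolynomial (Fin 3) (ZMod 2)) (Ideal.span {Nega.g3}) 2 := by
    refine Algebra.subset_adjoin ⟨1, by norm_num, X 2 ^ 2, ?_, rfl⟩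
    have h := apply_mem_diffIdeal (ZMod 2) (Derivation.isDiffOpLE_one (pderiv 0))
      (Ideal.mem_span_singleton_self Nega.g3)
    rwa [Derivation.coeFn_coe, pderiv0_g1] at h
  rw [pAlgebraicRing, Subalgebra.mem_restrictScalars, mem_integralClosure_iff]
  exact isIntegral_algebraMap
    (x := (⟨_, hmem⟩ : diffSubalgebra (ZMod 2) (MvPolynomial (Fin 3) (ZMod 2)) (Ideal.span {Nega.g3}) 2))

/-- LOWER BOUND, all `k`: `w^{2k} ∈ ℘(Ě_{W1}, k)` (`(w²X)^k`). [folklore] -/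
theorem W1_sq_pow_mem_homogPiece (k : ℕ) :
    (X 2 ^ (2 * k) : MvPolynomial (Fin 3) (ZMod 2)) ∈ homogPiece (MvPolynomial (Fin 3) (ZMod 2))
      (pAlgebraicRing (ZMod 2) (MvPolynomial (Fin 3) (ZMod 2)) (Ideal.span {Nega.g3}) 2) k := by
  rw [homogPiece, Submodule.mem_comap, Subalgebra.mem_toSubmodule]
  have h := Subalgebra.pow_mem _ W1_sq_mem_pAlgebraicRing k
  rwa [Polynomial.monomial_pow, one_mul, ← pow_mul] at h

/-- **UPPER BOUND, all `k`, closure included: `℘(Ě_{W1}, k) ∩ 𝔽₂[x,w] ⊆ (w^{2k})`.** Along the Frobenius arc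
(`t^4 ∣ φ(w)² = t⁴`) every `a ∈ ℘(Ě,k)` has `t^{4k} ∣ φ(a)`; for `a = β^*c` this reads `t^{4k} ∣ c²`, i.e.
`w^{2k} ∣ c`. Table 2.1 (row W1) of the K1.4 report, there `k ≤ 4` by Gröbner bases on the algebra without closure
+ V2007 Th 4.11 as dictionary; here every `k`, inside the kernel. [folklore] -/
theorem W1_homogPiece_comap_le (k : ℕ) :
    (homogPiece (MvPolynomial (Fin 3) (ZMod 2))
        (pAlgebraicRing (ZMod 2) (MvPolynomial (Fin 3) (ZMod 2)) (Ideal.span {Nega.g3}) 2) k).comap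
      (rename ![(0 : Fin 3), 2]).toRingHom ≤ Ideal.span {(X 1 ^ (2 * k) : MvPolynomial (Fin 2) (ZMod 2))} := by
  intro c hc
  rw [Ideal.mem_comap, homogPiece, Submodule.mem_comap, Subalgebra.mem_toSubmodule] at hc
  set φ : MvPolynomial (Fin 3) (ZMod 2) →ₐ[ZMod 2] MvPolynomial (Fin 2) (ZMod 2) :=
    aeval ![X 0 ^ 2, X 0 * X 1 ^ 2, X 1 ^ 2] with hφ
  have hφ0 : φ (X 0) = X 0 ^ 2 := by simp [hφ]
  have hφ1 : φ (X 1) = X 0 * X 1 ^ 2 := by simp [hφ]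
  have hφ2 : φ (X 2) = X 1 ^ 2 := by simp [hφ]
  have he : (X 1 : MvPolynomial (Fin 2) (ZMod 2)) ^ 4 ∣ φ.toRingHom (X 2) ^ 2 := by
    rw [AlgHom.toRingHom_eq_coe, RingHom.coe_coe, hφ2, ← pow_mul]
  have h := W1_prime_pow_dvd φ.toRingHom (frobArc_g3 φ hφ0 hφ1 hφ2) (prime_X_fin2 1) he hc
  rw [AlgHom.toRingHom_eq_coe, RingHom.coe_coe, AlgHom.toRingHom_eq_coe, RingHom.coe_coe,
    frobArc_rename φ hφ0 hφ2, show 4 * k = 2 * (2 * k) by ring] at h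
  exact Ideal.mem_span_singleton.mpr (pow_dvd_of_sq (prime_X_fin2 1) h)

/-- **`J_k(Ě_{W1}, β) = (w^{2k})` for EVERY `k`** — the degree-`k` elimination ideal of reading (A)
(res-L1-type-o2's `Campaign.elimAlgPiece`, base structure `β^* = rename ![0,2]`: `x ↦ x`, `w ↦ w`, projection off
`y`) of `Ě_{W1} = ((y² + xw²), 2)` is principal, generated by the square `w^{2k}`; so `℘(Ě_{W1}) ∩ S[W] = 𝔽₂[x,w][w²·W]`
exactly (K1.4 report table 2.1, row W1 — now all degrees and inside the kernel). [folklore] -/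
theorem W1_elimAlgPiece_eq (k : ℕ) :
    letI : Algebra (MvPolynomial (Fin 2) (ZMod 2)) (MvPolynomial (Fin 3) (ZMod 2)) :=
      (rename ![(0 : Fin 3), 2]).toRingHom.toAlgebra
    elimAlgPiece (MvPolynomial (Fin 2) (ZMod 2)) (ZMod 2) (Ideal.span {Nega.g3}) 2 k =
      Ideal.span {(X 1 ^ (2 * k) : MvPolynomial (Fin 2) (ZMod 2))} := by
  letI : Algebra (MvPolynomial (Fin 2) (ZMod 2)) (MvPolynomial (Fin 3) (ZMod 2)) :=
    (rename ![(0 : Fin 3), 2]).toRingHom.toAlgebra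
  rw [elimAlgPiece_eq_comap]
  refine le_antisymm (W1_homogPiece_comap_le k) ?_
  rw [Ideal.span_le, Set.singleton_subset_iff, SetLike.mem_coe, Ideal.mem_comap, RingHom.algebraMap_toAlgebra]
  have h : (rename ![(0 : Fin 3), 2]).toRingHom (X 1 ^ (2 * k) : MvPolynomial (Fin 2) (ZMod 2)) = X 2 ^ (2 * k) := by
    simp
  rw [h]
  exact W1_sq_pow_mem_homogPiece k

end Upstairs

/-! ## §6 The `x`-chart at `ξ′` (the (59)-failure point of p470685), all degrees: THE LAW -/

section XChart

/-- Compatibility of the charts (BV2010 Th 3.1 (ii)'s square in one chart): `σ ∘ β^* = β₁^* ∘ σ′` for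
`σ = Nega.xChart` (`x ↦ x`, `y ↦ xy₁`, `w ↦ xw₁`), `σ′ : x ↦ x, w ↦ xw₁` on the base, `β^* = β₁^* = rename ![0,2]`.
[folklore] -/
theorem xChart_comp_rename :
    Nega.xChart.toRingHom.comp (rename ![(0 : Fin 3), 2]).toRingHom =
      (rename ![(0 : Fin 3), 2]).toRingHom.comp
        (aeval ![X 0, X 0 * X 1] : MvPolynomial (Fin 2) (ZMod 2) →ₐ[ZMod 2] MvPolynomial (Fin 2) (ZMod 2)).toRingHom := by
  apply MvPolynomial.ringHom_ext
  · intro r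
    simp
  · intro i
    fin_cases i <;> simp [Nega.xChart]

/-- **THE `x`-CHART DIVISIBILITY, all `k`.** If `c ∈ S₁ = 𝔽₂[x,w₁]` has `β₁^*(c)·x^k ∈ ℘(Ě_{W1},k)·O₁` (pushed along
`σ = Nega.xChart`) — i.e. `c` lies in the envelope `(℘(Ě,k)O₁ : x^k) ∩ S₁` of the weak transform — then
`x^k·w₁^{2k} ∣ c`: along `ψ = φ∘σ` (`ψ(w)² = s⁴t⁴`) one has `s^{4k}, t^{4k} ∣ ψ(a)` on `℘(Ě,k)` (`W1_prime_pow_dvd`),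
hence `s^{4k}t^{4k} ∣ φ(β₁^*c)·s^{2k} = c²s^{2k}`. The factor `x^k` is the exceptional MONOMIAL factor `I(H)^k` of the
report's located ceiling (§2.4). [folklore] -/
theorem W1_xChart_dvd (k : ℕ) (c : MvPolynomial (Fin 2) (ZMod 2))
    (hc : (rename ![(0 : Fin 3), 2]).toRingHom c * X 0 ^ k ∈
      (homogPiece (MvPolynomial (Fin 3) (ZMod 2))
        (pAlgebraicRing (ZMod 2) (MvPolynomial (Fin 3) (ZMod 2)) (Ideal.span {Nega.g3}) 2) k).map
        Nega.xChart.toRingHom) :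
    X 0 ^ k * X 1 ^ (2 * k) ∣ c := by
  set φ : MvPolynomial (Fin 3) (ZMod 2) →ₐ[ZMod 2] MvPolynomial (Fin 2) (ZMod 2) :=
    aeval ![X 0 ^ 2, X 0 * X 1 ^ 2, X 1 ^ 2] with hφ
  have hφ0 : φ (X 0) = X 0 ^ 2 := by simp [hφ]
  have hφ1 : φ (X 1) = X 0 * X 1 ^ 2 := by simp [hφ]
  have hφ2 : φ (X 2) = X 1 ^ 2 := by simp [hφ]
  set ψ : MvPolynomial (Fin 3) (ZMod 2) →+* MvPolynomial (Fin 2) (ZMod 2) :=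
    φ.toRingHom.comp Nega.xChart.toRingHom with hψdef
  have hψg : ψ Nega.g3 = 0 := frobArc_xChart_g3 φ hφ0 hφ1 hφ2
  have hψ2 : ψ (X 2) ^ 2 = X 0 ^ 4 * X 1 ^ 4 := by
    rw [hψdef, frobArc_xChart_X2 φ hφ0 hφ2]
    ring
  -- the arc bound on `℘(Ě,k)`, prime by prime
  set I : Ideal (MvPolynomial (Fin 2) (ZMod 2)) :=
    Ideal.span {X 0 ^ (4 * k)} ⊓ Ideal.span {X 1 ^ (4 * k)} with hI
  have hle : (homogPiece (MvPolynomial (Fin 3) (ZMod 2))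
      (pAlgebraicRing (ZMod 2) (MvPolynomial (Fin 3) (ZMod 2)) (Ideal.span {Nega.g3}) 2) k).map
      Nega.xChart.toRingHom ≤ I.comap φ.toRingHom := by
    rw [Ideal.map_le_iff_le_comap, Ideal.comap_comap]
    intro a ha
    rw [homogPiece, Submodule.mem_comap, Subalgebra.mem_toSubmodule] at ha
    rw [Ideal.mem_comap, hI, Ideal.mem_inf, Ideal.mem_span_singleton, Ideal.mem_span_singleton]
    have he0 : (X 0 : MvPolynomial (Fin 2) (ZMod 2)) ^ 4 ∣ ψ (X 2) ^ 2 := by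
      rw [hψ2]; exact dvd_mul_right _ _
    have he1 : (X 1 : MvPolynomial (Fin 2) (ZMod 2)) ^ 4 ∣ ψ (X 2) ^ 2 := by
      rw [hψ2]; exact dvd_mul_left _ _
    exact ⟨W1_prime_pow_dvd ψ hψg (prime_X_fin2 0) he0 ha, W1_prime_pow_dvd ψ hψg (prime_X_fin2 1) he1 ha⟩
  have hcI := hle hc
  rw [Ideal.mem_comap, hI, Ideal.mem_inf, Ideal.mem_span_singleton, Ideal.mem_span_singleton, map_mul,
    map_pow] at hcI
  simp only [AlgHom.toRingHom_eq_coe, RingHom.coe_coe] at hcI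
  rw [frobArc_rename φ hφ0 hφ2, hφ0, ← pow_mul] at hcI
  obtain ⟨h0, h1⟩ := hcI
  -- `s^{4k} ∣ c²·s^{2k}` ⇒ `s^{2k} ∣ c²` ⇒ `s^k ∣ c`
  have h0' : (X 0 : MvPolynomial (Fin 2) (ZMod 2)) ^ (2 * k) ∣ c ^ 2 := by
    have hsplit : (X 0 : MvPolynomial (Fin 2) (ZMod 2)) ^ (4 * k) = X 0 ^ (2 * k) * X 0 ^ (2 * k) := by
      rw [← pow_add]; ring_nf
    rw [hsplit] at h0
    exact (mul_dvd_mul_iff_right (pow_ne_zero _ (MvPolynomial.X_ne_zero 0))).mp h0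
  have hx : (X 0 : MvPolynomial (Fin 2) (ZMod 2)) ^ k ∣ c := pow_dvd_of_sq (prime_X_fin2 0) h0'
  -- `t^{4k} ∣ c²·s^{2k}` ⇒ `t^{4k} ∣ c²` ⇒ `t^{2k} ∣ c`
  have h1' : (X 1 : MvPolynomial (Fin 2) (ZMod 2)) ^ (2 * (2 * k)) ∣ c ^ 2 := by
    rw [show 2 * (2 * k) = 4 * k by ring]
    exact (prime_X_fin2 1).pow_dvd_of_dvd_mul_right _ (not_X_one_dvd_X_zero_pow _) h1
  have hw : (X 1 : MvPolynomial (Fin 2) (ZMod 2)) ^ (2 * k) ∣ c := pow_dvd_of_sq (prime_X_fin2 1) h1'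
  obtain ⟨q, rfl⟩ := hx
  have hq : (X 1 : MvPolynomial (Fin 2) (ZMod 2)) ^ (2 * k) ∣ q :=
    (prime_X_fin2 1).pow_dvd_of_dvd_mul_left _ (not_X_one_dvd_X_zero_pow _) hw
  obtain ⟨r, rfl⟩ := hq
  exact ⟨r, by ring⟩

/-- `(x·w₁²)^k` lies in the LHS: `β₁^*((xw₁²)^k)·x^k = x^{2k}w^{2k}∘… = σ(w^{2k})` with `w^{2k} ∈ ℘(Ě,k)` — the
cheap half on the instance. [folklore] -/
theorem W1_xChart_monomial_mem (k : ℕ) :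
    (rename ![(0 : Fin 3), 2]).toRingHom ((X 0 * X 1 ^ 2) ^ k : MvPolynomial (Fin 2) (ZMod 2)) * X 0 ^ k ∈
      (homogPiece (MvPolynomial (Fin 3) (ZMod 2))
        (pAlgebraicRing (ZMod 2) (MvPolynomial (Fin 3) (ZMod 2)) (Ideal.span {Nega.g3}) 2) k).map
        Nega.xChart.toRingHom := by
  have h := Ideal.mem_map_of_mem Nega.xChart.toRingHom (W1_sq_pow_mem_homogPiece k)
  have hσ : Nega.xChart.toRingHom (X 2 ^ (2 * k) : MvPolynomial (Fin 3) (ZMod 2)) = (X 0 * X 2) ^ (2 * k) := by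
    simp [Nega.xChart]
  have hβ : (rename ![(0 : Fin 3), 2]).toRingHom ((X 0 * X 1 ^ 2) ^ k : MvPolynomial (Fin 2) (ZMod 2)) * X 0 ^ k =
      (X 0 * X 2) ^ (2 * k) := by
    simp only [AlgHom.toRingHom_eq_coe, RingHom.coe_coe, map_pow, map_mul, MvPolynomial.rename_X]
    simp
    ring
  rw [hβ, ← hσ]
  exact h

/-- **THE LHS OF THE LAW, EXACTLY, all `k`: `(℘(Ě_{W1},k)·O₁ : x^k) ∩ S₁ = ((x·w₁²)^k)`** — the envelope of the
weak transform in the `x`-chart at `ξ′` (o2's `Campaign.weakPiece σ x ℘(Ě,·) k`, contracted along `β₁^*`) is the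
principal ideal generated by `x^k·w₁^{2k} = I(H)^k·(w₁²)^k`: exceptional monomial factor times the object of the
transform (K1.4 report table 2.2, `x`-chart row: there `k ≤ 4` by Gröbner bases; here every `k`, closure included).
[folklore] -/
theorem W1_xChart_lhs_eq (k : ℕ) :
    (weakPiece Nega.xChart.toRingHom (X 0 : MvPolynomial (Fin 3) (ZMod 2))
        (homogPiece (MvPolynomial (Fin 3) (ZMod 2))
          (pAlgebraicRing (ZMod 2) (MvPolynomial (Fin 3) (ZMod 2)) (Ideal.span {Nega.g3}) 2)) k).comap
      (rename ![(0 : Fin 3), 2]).toRingHom =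
      Ideal.span {((X 0 * X 1 ^ 2) ^ k : MvPolynomial (Fin 2) (ZMod 2))} := by
  ext c
  rw [Ideal.mem_comap, mem_weakPiece_iff, Ideal.mem_span_singleton]
  constructor
  · intro hc
    rw [mul_pow, ← pow_mul]
    exact W1_xChart_dvd k c hc
  · rintro ⟨r, rfl⟩
    rw [map_mul, mul_right_comm]
    exact Ideal.mul_mem_right _ _ (W1_xChart_monomial_mem k)

/-- **K1.4 (ii) IN THE KERNEL, ALL DEGREES — the literal schema instance.** The transformation law of the
reading-(A) elimination algebra (res-L1-type-o2's `CampaignW14.ElimTransformLawChart`, BV2010 Th 3.1 (ii)(b)-SHAPE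
transported to «`℘(Ě) ∩ S[W]`», STATED NOT CLAIMED in `MarkedTransferCampaignW14ElimAlgebra.lean`) HOLDS on the R04
calibration witness W1 = `((y² + xw²), 2)` over `𝔽₂` in the `x`-chart of the blow-up of the origin
(`σ = Nega.xChart`, `σ′ : x ↦ x, w ↦ xw₁`, exceptional equations `u = x`, `u′ = x`, base structures
`β^* = β₁^* = rename ![0,2]`), at the very point `ξ′` where the printed (59)-shape fails for every `℘̃` (p470685): for
EVERY degree `k` and every `c` in the envelope of the weak transform, `c·X^k` lies IN (hence is integral over) the
`S₁`-algebra of the weak transforms `(J_k S₁ : x^k)` of the elimination ideals — by `W1_xChart_dvd` and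
`w^{2k} ∈ J_k`. Together with o2's proved cheap half `Campaign.weakPiece_elim_le`: EQUALITY, not merely up to integral
closure, as the CAS found for `k ≤ 4` (kit j265389). Closes KILL-TEST-K1.4.md §4 (β) / §5 F1 «kernel-general OPEN».
NOT a statement of the manuscript or of V2007/BV2010; an OURS instance, AI-adjudicated bookkeeping. [folklore] -/
theorem W1_xChart_elimTransformLaw :
    letI : Algebra (MvPolynomial (Fin 2) (ZMod 2)) (MvPolynomial (Fin 3) (ZMod 2)) :=
      (rename ![(0 : Fin 3), 2]).toRingHom.toAlgebra
    CampaignW14.ElimTransformLawChart (K := ZMod 2) Nega.xChart.toRingHom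
      (aeval ![X 0, X 0 * X 1] : MvPolynomial (Fin 2) (ZMod 2) →ₐ[ZMod 2] MvPolynomial (Fin 2) (ZMod 2)).toRingHom
      (X 0 : MvPolynomial (Fin 3) (ZMod 2)) (X 0 : MvPolynomial (Fin 2) (ZMod 2)) (Ideal.span {Nega.g3}) 2 := by
  letI : Algebra (MvPolynomial (Fin 2) (ZMod 2)) (MvPolynomial (Fin 3) (ZMod 2)) :=
    (rename ![(0 : Fin 3), 2]).toRingHom.toAlgebra
  intro k c hc
  rw [mem_weakPiece_iff, RingHom.algebraMap_toAlgebra] at hc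
  obtain ⟨r, hr⟩ := W1_xChart_dvd k c hc
  set σ' : MvPolynomial (Fin 2) (ZMod 2) →+* MvPolynomial (Fin 2) (ZMod 2) :=
    (aeval ![X 0, X 0 * X 1] : MvPolynomial (Fin 2) (ZMod 2) →ₐ[ZMod 2] MvPolynomial (Fin 2) (ZMod 2)).toRingHom with hσ'
  have hmem : c ∈ weakPiece σ' (X 0)
      (elimAlgPiece (MvPolynomial (Fin 2) (ZMod 2)) (ZMod 2) (Ideal.span {Nega.g3}) 2) k := by
    rw [mem_weakPiece_iff]
    have hw : (X 1 ^ (2 * k) : MvPolynomial (Fin 2) (ZMod 2)) ∈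
        elimAlgPiece (MvPolynomial (Fin 2) (ZMod 2)) (ZMod 2) (Ideal.span {Nega.g3}) 2 k := by
      rw [W1_elimAlgPiece_eq k]
      exact Ideal.mem_span_singleton_self _
    have h1 := Ideal.mem_map_of_mem σ' hw
    have h2 : σ' (X 1 ^ (2 * k)) = (X 0 * X 1) ^ (2 * k) := by
      simp [hσ']
    have h3 : c * X 0 ^ k = r * σ' (X 1 ^ (2 * k)) := by
      rw [h2, hr]
      ring
    rw [h3]
    exact Ideal.mul_mem_left _ r h1
  have hmono : Polynomial.monomial k c ∈ familySubalgebra (MvPolynomial (Fin 2) (ZMod 2))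
      (weakPiece σ' (X 0) (elimAlgPiece (MvPolynomial (Fin 2) (ZMod 2)) (ZMod 2) (Ideal.span {Nega.g3}) 2)) :=
    Algebra.subset_adjoin ⟨k, c, hmem, rfl⟩
  exact isIntegral_algebraMap (x := (⟨_, hmono⟩ : familySubalgebra (MvPolynomial (Fin 2) (ZMod 2))
    (weakPiece σ' (X 0) (elimAlgPiece (MvPolynomial (Fin 2) (ZMod 2)) (ZMod 2) (Ideal.span {Nega.g3}) 2))))

end XChart

end Summit.ResolutionOfSingularities.ResolutionOfSingularities.Theorems.Campaign.W14.Law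

end
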